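import Summits.AtomisticToContinuum.Crystallization.Theses.PhononSlackCertificates

/-!
# `NearFarGlueR` (stmt-AtomisticToContinuum-14970), negative side I: both antecedents are void on thin sets

Route `PhononSlackCertificates`, crux `NearFarGlueR : FarFieldGapR → NearFieldConvexity →
CoerciveTwoShellGap` (rank 4).  Load-bearing analysis by the standing disprover
(refuter-cdisprove-stmt-AtomisticToContinuum-14970-0; the same observation was made independently by
refuter-rattack-stmt-AtomisticToContinuum-14970-0, evidence `Evidence14970.lean`).

* `halfSite_ge` — site energies of a `δ`-separated configuration are `≥ −(125/6)·δ⁻⁶`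
  (`sum_inv_pow_six_le` + the attractive tail `V_LJ ≥ −r⁻⁶/6`).
* `farField_ineq_of_thin` — the inequality of `FarFieldGapR` holds OUTRIGHT, for every `δ > 0`,
  every `g` and every `R`, with `C := g + 125/6·δ⁻⁶ + e*`, on every index set `U` each of whose
  particles has a non-`U` particle within `R` (then the boundary count is all of `U`).  Badness is
  not used.
* `nearField_ineq_of_thin` — the inequality of `NearFieldConvexity` holds OUTRIGHT on every
  `4`-thin `Ω`, for every `c ≥ 0`, with `C := c + 125/6·δ⁻⁶ + e*`, whatever the "non-layered"
  predicate is.  Goodness and layeredness are not used.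
* `contactGapAt_of_coerciveTwoShellGap` — the residual of the picked line `Sketch` (the contact
  gap at radius `r`; `r = 3` is the lead's `stub_contactGap`: bad particles within `3` of a good one
  pay `g₂` each in the total energy) is implied by the target `CoerciveTwoShellGap` with the same `g`.

Consequence (costume warning, not a refutation): on a configuration whose bad set is `R(δ)`-thin —
free surfaces, grain boundaries, point defects, dislocation cores, mildly distorted shells — the
glue receives nothing from its two hypotheses (their `∃ C` absorbs everything), so any proof of
`NearFarGlueR` proves `CoerciveTwoShellGap` on thin bad sets from scratch; the line `Sketch`
isolates exactly this residual (contact gap at radius `3`).  All `[folklore]`.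
-/

noncomputable section

namespace Summit.AtomisticToContinuum.Crystallization.Theorems.NearFarGlueRNegative

open scoped BigOperators
open Literature.MathematicalPhysics.StatisticalMechanics Literature.Geometry.DiscreteGeometry
open Summit.AtomisticToContinuum.Crystallization.Theses.PhononSlackCertificates

/-- **Site energies are bounded below** on `δ`-separated configurations:
`½ Σ_{j ≠ i} V_LJ(|x_i − x_j|) ≥ −(125/6)·δ⁻⁶`. [folklore] -/
theorem halfSite_ge {N : ℕ} {δ : ℝ} (hδ : 0 < δ) (x : Fin N → EuclideanSpace ℝ (Fin 3))
    (hsep : ∀ i j : Fin N, i ≠ j → δ ≤ dist (x i) (x j)) (i : Fin N) :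
    -((125 / 6 : ℝ) * δ⁻¹ ^ 6) ≤
      (1 / 2 : ℝ) * ∑ j ∈ Finset.univ.erase i, lennardJones (dist (x i) (x j)) := by
  have hshell := sum_inv_pow_six_le x hδ hsep i
  have hterm : ∀ j ∈ Finset.univ.erase i,
      -((1 / 6 : ℝ) * (dist (x i) (x j))⁻¹ ^ 6) ≤ lennardJones (dist (x i) (x j)) := by
    intro j hj
    have hij : i ≠ j := (Finset.ne_of_mem_erase hj).symm
    have hpos : 0 < dist (x i) (x j) := lt_of_lt_of_le hδ (hsep i j hij)
    exact neg_le_lennardJones_of_le hpos le_rfl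
  have hsum : -((1 / 6 : ℝ) * ∑ j ∈ Finset.univ.erase i, (dist (x i) (x j))⁻¹ ^ 6) ≤
      ∑ j ∈ Finset.univ.erase i, lennardJones (dist (x i) (x j)) := by
    rw [Finset.mul_sum, ← Finset.sum_neg_distrib]
    exact Finset.sum_le_sum hterm
  nlinarith [hsum, hshell]

/-- **`FarFieldGapR` is void on `R`-thin sets.** For every `δ > 0`, every `g`, every `R`: if each
particle of `U` has a non-`U` particle within `R`, the far-field inequality holds with
`C := g + 125/6·δ⁻⁶ + e*` — no badness, no certificate. [folklore] -/
theorem farField_ineq_of_thin {δ : ℝ} (hδ : 0 < δ) (g R : ℝ) {N : ℕ} (x : Fin N → EuclideanSpace ℝ (Fin 3))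
    (hsep : ∀ i j : Fin N, i ≠ j → δ ≤ dist (x i) (x j)) (U : Finset (Fin N))
    (hthin : ∀ i ∈ U, ∃ j : Fin N, j ∉ U ∧ dist (x j) (x i) ≤ R) :
    g * (U.card : ℝ) - (g + (125 / 6 : ℝ) * δ⁻¹ ^ 6 +
          (⨅ Q : PeriodicConfiguration 3, Q.energyPerParticle lennardJones)) *
        (Nat.card {i : Fin N // i ∈ U ∧ ∃ j : Fin N, j ∉ U ∧ dist (x j) (x i) ≤ R} : ℝ) ≤
      ∑ i ∈ U, ((1 / 2 : ℝ) * (∑ j ∈ Finset.univ.erase i, lennardJones (dist (x i) (x j))) -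
        (⨅ Q : PeriodicConfiguration 3, Q.energyPerParticle lennardJones)) := by
  set eStar : ℝ := ⨅ Q : PeriodicConfiguration 3, Q.energyPerParticle lennardJones
  have hcard : (Nat.card {i : Fin N // i ∈ U ∧ ∃ j : Fin N, j ∉ U ∧ dist (x j) (x i) ≤ R} : ℝ) =
      (U.card : ℝ) := by
    have e : {i : Fin N // i ∈ U ∧ ∃ j : Fin N, j ∉ U ∧ dist (x j) (x i) ≤ R} ≃
        {i : Fin N // i ∈ U} :=
      Equiv.subtypeEquivRight fun i => ⟨fun h => h.1, fun h => ⟨h, hthin i h⟩⟩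
    rw [Nat.card_congr e, Nat.card_eq_fintype_card, Fintype.card_coe]
  rw [hcard]
  have hpt : ∀ i ∈ U, -((125 / 6 : ℝ) * δ⁻¹ ^ 6) - eStar ≤
      (1 / 2 : ℝ) * (∑ j ∈ Finset.univ.erase i, lennardJones (dist (x i) (x j))) - eStar :=
    fun i _ => sub_le_sub_right (halfSite_ge hδ x hsep i) _
  have hs := Finset.sum_le_sum hpt
  simp only [Finset.sum_const, nsmul_eq_mul] at hs
  nlinarith [hs]

/-- **`NearFieldConvexity` is void on `4`-thin sets.** For every `δ > 0` and `c ≥ 0`: if each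
particle of `Ω` has a non-`Ω` particle within `4`, the near-field inequality holds with
`C := c + 125/6·δ⁻⁶ + e*`, for an ARBITRARY predicate `P` in place of "non-layered" — no goodness,
no phonons. [folklore] -/
theorem nearField_ineq_of_thin {δ : ℝ} (hδ : 0 < δ) {c : ℝ} (hc : 0 ≤ c) {N : ℕ} (x : Fin N → EuclideanSpace ℝ (Fin 3))
    (hsep : ∀ i j : Fin N, i ≠ j → δ ≤ dist (x i) (x j)) (Ω : Finset (Fin N)) (P : Fin N → Prop)
    (hthin : ∀ i ∈ Ω, ∃ j : Fin N, j ∉ Ω ∧ dist (x j) (x i) ≤ 4) :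
    c * (Nat.card {i : Fin N // i ∈ Ω ∧ P i} : ℝ) - (c + (125 / 6 : ℝ) * δ⁻¹ ^ 6 +
          (⨅ Q : PeriodicConfiguration 3, Q.energyPerParticle lennardJones)) *
        (Nat.card {i : Fin N // i ∈ Ω ∧ ∃ j : Fin N, j ∉ Ω ∧ dist (x j) (x i) ≤ 4} : ℝ) ≤
      ∑ i ∈ Ω, ((1 / 2 : ℝ) * (∑ j ∈ Finset.univ.erase i, lennardJones (dist (x i) (x j))) -
        (⨅ Q : PeriodicConfiguration 3, Q.energyPerParticle lennardJones)) := by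
  set eStar : ℝ := ⨅ Q : PeriodicConfiguration 3, Q.energyPerParticle lennardJones
  have hcard : (Nat.card {i : Fin N // i ∈ Ω ∧ ∃ j : Fin N, j ∉ Ω ∧ dist (x j) (x i) ≤ 4} : ℝ) =
      (Ω.card : ℝ) := by
    have e : {i : Fin N // i ∈ Ω ∧ ∃ j : Fin N, j ∉ Ω ∧ dist (x j) (x i) ≤ 4} ≃
        {i : Fin N // i ∈ Ω} :=
      Equiv.subtypeEquivRight fun i => ⟨fun h => h.1, fun h => ⟨h, hthin i h⟩⟩
    rw [Nat.card_congr e, Nat.card_eq_fintype_card, Fintype.card_coe]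
  have hle : (Nat.card {i : Fin N // i ∈ Ω ∧ P i} : ℝ) ≤ (Ω.card : ℝ) := by
    have h := Nat.card_le_card_of_injective
      (fun a : {i : Fin N // i ∈ Ω ∧ P i} => (⟨a.1, a.2.1⟩ : {i : Fin N // i ∈ Ω}))
      (fun a b hab => Subtype.ext (by simpa using congrArg Subtype.val hab))
    rw [Nat.card_eq_fintype_card (α := {i : Fin N // i ∈ Ω}), Fintype.card_coe] at h
    exact_mod_cast h
  rw [hcard]
  have hpt : ∀ i ∈ Ω, -((125 / 6 : ℝ) * δ⁻¹ ^ 6) - eStar ≤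
      (1 / 2 : ℝ) * (∑ j ∈ Finset.univ.erase i, lennardJones (dist (x i) (x j))) - eStar :=
    fun i _ => sub_le_sub_right (halfSite_ge hδ x hsep i) _
  have hs := Finset.sum_le_sum hpt
  simp only [Finset.sum_const, nsmul_eq_mul] at hs
  have h1 : c * (Nat.card {i : Fin N // i ∈ Ω ∧ P i} : ℝ) ≤ c * (Ω.card : ℝ) :=
    mul_le_mul_of_nonneg_left hle hc
  nlinarith [hs, h1]

/-- **The line's residual is a weakening of the target.**  For every contact radius `r`,
`CoerciveTwoShellGap` implies the contact gap at radius `r` — every bad particle within `r` of a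
good particle pays `g` in the total energy (verbatim the lead's `stub_contactGap` at `r = 3`; same
`g`, since the contact-bad particles are among the bad ones).  With the two theorems above: the
line `Sketch` reduces the glue to exactly the part of its conclusion that neither hypothesis
prices.  (Stated with the residual inlined, so that no named `Prop` is introduced here.) [folklore] -/
theorem contactGapAt_of_coerciveTwoShellGap (r : ℝ) (h : CoerciveTwoShellGap) :
    ∀ δ : ℝ, 0 < δ → ∃ g₂ : ℝ, 0 < g₂ ∧ ∀ (N : ℕ) (x : Fin N → EuclideanSpace ℝ (Fin 3)),
      (∀ i j : Fin N, i ≠ j → δ ≤ dist (x i) (x j)) →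
        (N : ℝ) * (⨅ Q : PeriodicConfiguration 3, Q.energyPerParticle lennardJones) +
            g₂ * (Nat.card {j : Fin N // ¬ IsTwoShellGood (1 / 20) (47 / 50) 1 x j ∧
              ∃ i : Fin N, IsTwoShellGood (1 / 20) (47 / 50) 1 x i ∧ dist (x i) (x j) ≤ r} : ℝ) ≤
          interactionEnergy lennardJones x := by
  intro δ hδ
  obtain ⟨g, hg, hall⟩ := h δ hδ
  refine ⟨g, hg, fun N x hsep => ?_⟩
  have hE := hall N x hsep
  have hle : (Nat.card {j : Fin N // ¬ IsTwoShellGood (1 / 20) (47 / 50) 1 x j ∧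
        ∃ i : Fin N, IsTwoShellGood (1 / 20) (47 / 50) 1 x i ∧ dist (x i) (x j) ≤ r} : ℝ) ≤
      (Nat.card {i : Fin N // ¬ IsTwoShellGood (1 / 20) (47 / 50) 1 x i} : ℝ) := by
    have h := Nat.card_le_card_of_injective
      (fun a : {j : Fin N // ¬ IsTwoShellGood (1 / 20) (47 / 50) 1 x j ∧
          ∃ i : Fin N, IsTwoShellGood (1 / 20) (47 / 50) 1 x i ∧ dist (x i) (x j) ≤ r} =>
        (⟨a.1, a.2.1⟩ : {i : Fin N // ¬ IsTwoShellGood (1 / 20) (47 / 50) 1 x i}))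
      (fun a b hab => Subtype.ext (by simpa using congrArg Subtype.val hab))
    exact_mod_cast h
  have := mul_le_mul_of_nonneg_left hle hg.le
  linarith

end Summit.AtomisticToContinuum.Crystallization.Theorems.NearFarGlueRNegative
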